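import Summits.QuantumFields.GaugeBoot.Certificates.SparseReducedWindow
import Summits.QuantumFields.GaugeBoot.Certificates.KZL2rpD4b3LoDA
import Summits.QuantumFields.GaugeBoot.Certificates.KZL2rpD4b3LoDB
import HarnessLib

/-!
# Kernel replay of the certsdp certificate `kzL2_D4_b3_max_rp_G2-lower` — part G: factor-row assembly and objective (gb_lean_emit_win 0.9)

HONEST FRAMING (cell `pub-gaugeboot`): certified bounds on lattice expectations at stated coupling,
gauge group, dimension and torus size; NOT a mass gap, NOT a continuum limit, NOT a string tension;
NOT Yang–Mills-summit-bearing (barriers `FixedCouplingUltralocality`, `PerturbativeInvisibility`).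

Certificate sha256 `8e344de0af2a64378a682606445ea2b7b460e1a728178d858abebca37e4de315` (problem `kzL2_D4_b3_max_rp_G2-lower`, sha256 `e61fcdb801c2d0fddc3a7e44a912e6996a28a74f1824d3d80c963fadc7172b0c`): `GB` = all factor rows (data parts
`Certificates/KZL2rpD4b3LoD….lean` concatenated), the INTEGER objective row `cZ`, the certified bound `lowerQ`, and the kernel check
`gb_len` (factor rows fit the padded dimension 48). Windows: `Certificates/KZL2rpD4b3LoA….lean`; assembly + theorems: `Certificates/KZL2rpD4b3Lo.lean`.
Data/plumbing only; nothing is claimed about lattice gauge theory in this file.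
-/

namespace Summit.QuantumFields.GaugeBoot.Certificates.KZL2rpD4b3Lo

noncomputable section

open Summit.QuantumFields.GaugeBoot.Certificates.Sparse

/-- All factor rows (concatenation of the data parts' block lists). -/
def GB : List (List (List ℤ)) := GBa ++ GBb

/-- Objective as a sparse INTEGER row: (1)·y_1. -/
def cZ : List (ℕ × ℤ) := [(1, 1)]

/-- The certified lower bound on the objective (exact): `2840472594700352071835519/5440166188265831286177792` (≈ 0.5221297468499). -/
def lowerQ : ℚ := 2840472594700352071835519/5440166188265831286177792

set_option maxHeartbeats 0 in
/-- Kernel check: every factor row of every block has length `≤ 48`. -/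
theorem gb_len : lenCheckAll KZL2rpD4b3Lo.GB 48 70 = true := by
  decide +kernel

end

end Summit.QuantumFields.GaugeBoot.Certificates.KZL2rpD4b3Lo
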